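import Mathlib.Analysis.SpecialFunctions.Pow.Real
import Mathlib.Algebra.BigOperators.Fin
import Mathlib.Data.Fin.Tuple.Basic
import HarnessLib

/-!
# Signed weighted hard-core words on a path and on a cycle: a transfer potential with sign contraction

**Sources.** R. P. Stanley, *Enumerative Combinatorics* I (2nd ed., 2012), §4.7 (the transfer-matrix method:
weighted words avoiding a forbidden factor are counted by products of `2 × 2` transfer matrices / a
two-term linear recursion; Theorem 4.7.2 for closed walks = cyclic words) [Stanley2012EC1].

Setting.  Boolean words `v ∈ {0,1}^{j+1}` with NO TWO CONSECUTIVE ZEROS (the hard-core / Fibonacci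
constraint), weighted multiplicatively by a weight `a_i` for a zero at site `i` and `b_i` for a one at site
`i`.  The partial sums `A_j` (words ending in `1`) and `B_j` (ending in `0`) obey the transfer recursion
`A_{j+1} = b_{j+1}(A_j + B_j)`, `B_{j+1} = a_{j+1} A_j` (`endSum_succ_true/false`) — the printed method.

SUPPLIED HERE (not printed in this form): for the FUGACITY-2 hard-core weights `a_i = 2` and SIGNS
`b_i ∈ {1, −1}` (`i ≥ 1`; site `0` arbitrary with `0 ≤ a_0 ≤ 2`, `|b_0| ≤ 1`) the quadratic potential
`qf A B = 5A² + 2AB + 2B²` (adapted to the eigenbasis of the transfer matrix `[[1,1],[2,0]]`, eigenvalues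
`2, −1`) satisfies `qf ∘ step ≤ 4·qf` at a site with `b = 1` and `≤ (64/25)·qf` at a site with `b = −1`
(`qf_step_pos`, `qf_step_neg`), whence

* `abs_total_le`: `|Σ_{v hard-core linear} ∏ (weights)| ≤ 5 · 2^j · (4/5)^{#{1 ≤ i ≤ j : b_i = −1 certified}}`;
* `abs_cycSum_le`: the same words with the CYCLIC constraint (not both end letters zero):
  `|Σ| ≤ 10 · 2^j · (4/5)^{#signed sites in [1, j]}` — by splitting on the first letter, no trace identity;
* `abs_cycSum_two_sign_le`: the case `a ≡ 2`, `b_i = −1` on a set `I`, `+1` elsewhere: the signed count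
  `Σ_{v cyclic hard-core} 2^{#zeros(v)} (−1)^{#(I ∩ ones(v))}` is at most `10 · 2^j · (4/5)^{#(I ∩ [1,j])}` in
  absolute value — exponentially small against the total mass `2^{j+1} ± 1` of the fugacity-2 hard-core gas
  on the cycle, uniformly in the shape of `I`.

Everything is PROVED; no named facts.  (Application: the parity of the number of occupied sites of a fixed
set under the fugacity-2 hard-core measure on a cycle has bias `≤ 10·(4/5)^{|I|−1}`.)
-/

noncomputable section

namespace Literature.Probability.LatticeModels

namespace HardCoreSigned

open Finset

/-! ## Words, weights, the no-two-zeros constraint [Stanley2012EC1, §4.7] -/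

/-- Weight of a Boolean word: `a_i` for a zero at site `i`, `b_i` for a one at site `i`.
[cite: Stanley2012EC1, §4.7 (transfer-matrix method)] -/
def wordWt (a b : ℕ → ℝ) {j : ℕ} (v : Fin j → Bool) : ℝ :=
  ∏ i : Fin j, (if v i = false then a i.val else b i.val)

/-- Linear hard-core constraint: no two consecutive zeros. [cite: Stanley2012EC1, §4.7 (transfer-matrix method)] -/
def NoAdj {j : ℕ} (v : Fin j → Bool) : Prop :=
  ∀ i : Fin j, ∀ h : i.val + 1 < j, ¬ (v i = false ∧ v ⟨i.val + 1, h⟩ = false)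

open scoped Classical in
/-- The partial sums: words of length `j+1` with no two consecutive zeros, ending in the letter `c`
(`A_j = endSum a b j true`, `B_j = endSum a b j false`). [cite: Stanley2012EC1, §4.7 (transfer-matrix method)] -/
def endSum (a b : ℕ → ℝ) (j : ℕ) (c : Bool) : ℝ :=
  ∑ v : Fin (j + 1) → Bool, if (NoAdj v ∧ v (Fin.last j) = c) then wordWt a b v else 0

/-! ## The transfer recursion -/

/-- Weight of a snoc-extended word. [folklore] -/
private theorem wordWt_snoc (a b : ℕ → ℝ) {j : ℕ} (v : Fin (j + 1) → Bool) (c : Bool) :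
    wordWt a b (Fin.snoc v c : Fin (j + 2) → Bool)
      = wordWt a b v * (if c = false then a (j + 1) else b (j + 1)) := by
  unfold wordWt
  rw [Fin.prod_univ_castSucc]
  congr 1
  · refine prod_congr rfl fun i _ => ?_
    rw [Fin.snoc_castSucc]
    rfl
  · rw [Fin.snoc_last]
    rfl

/-- The no-two-zeros constraint of a snoc-extended word. [folklore] -/
private theorem noAdj_snoc_iff {j : ℕ} (v : Fin (j + 1) → Bool) (c : Bool) :
    NoAdj (Fin.snoc v c : Fin (j + 2) → Bool) ↔ (NoAdj v ∧ ¬ (v (Fin.last j) = false ∧ c = false)) := by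
  constructor
  · intro h
    constructor
    · intro i hi hc
      have h' := h (Fin.castSucc i) (by simp; omega)
      apply h'
      have e1 : (⟨(Fin.castSucc i).val + 1, by simp; omega⟩ : Fin (j + 2)) = Fin.castSucc ⟨i.val + 1, hi⟩ :=
        Fin.ext (by simp)
      rw [Fin.snoc_castSucc, e1, Fin.snoc_castSucc]
      exact hc
    · intro hc
      have h' := h (Fin.castSucc (Fin.last j)) (by simp)
      apply h'
      have e1 : (⟨(Fin.castSucc (Fin.last j)).val + 1, by simp⟩ : Fin (j + 2)) = Fin.last (j + 1) :=
        Fin.ext (by simp)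
      rw [Fin.snoc_castSucc, e1, Fin.snoc_last]
      exact hc
  · rintro ⟨hv, hc⟩ i hi hbad
    obtain ⟨hb1, hb2⟩ := hbad
    by_cases hlt : i.val + 1 < j + 1
    · have hi' : i.val < j + 1 := by omega
      have e0 : i = Fin.castSucc ⟨i.val, hi'⟩ := Fin.ext (by simp)
      have e1 : (⟨i.val + 1, hi⟩ : Fin (j + 2)) = Fin.castSucc ⟨i.val + 1, hlt⟩ := Fin.ext (by simp)
      rw [e1, Fin.snoc_castSucc] at hb2
      rw [e0, Fin.snoc_castSucc] at hb1
      exact hv ⟨i.val, hi'⟩ hlt ⟨hb1, hb2⟩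
    · have hiv : i.val = j := by omega
      have e0 : i = Fin.castSucc (Fin.last j) := Fin.ext (by simp [hiv])
      have e1 : (⟨i.val + 1, hi⟩ : Fin (j + 2)) = Fin.last (j + 1) := Fin.ext (by simp [hiv])
      rw [e1, Fin.snoc_last] at hb2
      rw [e0, Fin.snoc_castSucc] at hb1
      exact hc ⟨hb1, hb2⟩

/-- Sums over words of length `j+2` as sums over (last letter, prefix). [folklore] -/
private theorem sum_snoc {j : ℕ} (G : (Fin (j + 2) → Bool) → ℝ) :
    ∑ u : Fin (j + 2) → Bool, G u = ∑ c : Bool, ∑ v : Fin (j + 1) → Bool, G (Fin.snoc v c) := by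
  rw [← (Fin.snocEquiv fun _ : Fin (j + 2) => Bool).sum_comp, Fintype.sum_prod_type]
  rfl

/-- **Transfer recursion, last letter `1`**: `A_{j+1} = b_{j+1} (A_j + B_j)`.
[cite: Stanley2012EC1, §4.7 (transfer-matrix method)] -/
theorem endSum_succ_true (a b : ℕ → ℝ) (j : ℕ) :
    endSum a b (j + 1) true = b (j + 1) * (endSum a b j true + endSum a b j false) := by
  classical
  unfold endSum
  rw [sum_snoc, Fintype.sum_bool, mul_add, mul_sum, mul_sum]
  have hfalse : ∑ v : Fin (j + 1) → Bool,
      (if (NoAdj (Fin.snoc v false : Fin (j + 2) → Bool) ∧ (Fin.snoc v false : Fin (j + 2) → Bool) (Fin.last (j + 1)) = true)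
        then wordWt a b (Fin.snoc v false : Fin (j + 2) → Bool) else 0) = 0 := by
    refine sum_eq_zero fun v _ => ?_
    rw [Fin.snoc_last]
    simp
  rw [hfalse, add_zero, ← sum_add_distrib]
  refine sum_congr rfl fun v _ => ?_
  simp only [Fin.snoc_last, noAdj_snoc_iff, wordWt_snoc]
  by_cases hv : NoAdj v
  · cases v (Fin.last j) <;> simp [hv, mul_comm]
  · simp [hv]

/-- **Transfer recursion, last letter `0`**: `B_{j+1} = a_{j+1} A_j`. [cite: Stanley2012EC1, §4.7 (transfer-matrix method)] -/
theorem endSum_succ_false (a b : ℕ → ℝ) (j : ℕ) :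
    endSum a b (j + 1) false = a (j + 1) * endSum a b j true := by
  classical
  unfold endSum
  rw [sum_snoc, Fintype.sum_bool, mul_sum]
  have htrue : ∑ v : Fin (j + 1) → Bool,
      (if (NoAdj (Fin.snoc v true : Fin (j + 2) → Bool) ∧ (Fin.snoc v true : Fin (j + 2) → Bool) (Fin.last (j + 1)) = false)
        then wordWt a b (Fin.snoc v true : Fin (j + 2) → Bool) else 0) = 0 := by
    refine sum_eq_zero fun v _ => ?_
    rw [Fin.snoc_last]
    simp
  rw [htrue, zero_add]
  refine sum_congr rfl fun v _ => ?_
  simp only [Fin.snoc_last, noAdj_snoc_iff, wordWt_snoc]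
  by_cases hv : NoAdj v
  · cases v (Fin.last j) <;> simp [hv, mul_comm]
  · simp [hv]

/-- Base: the one-letter words, `A_0 = b_0`, `B_0 = a_0`. [cite: Stanley2012EC1, §4.7 (transfer-matrix method)] -/
theorem endSum_zero (a b : ℕ → ℝ) : endSum a b 0 true = b 0 ∧ endSum a b 0 false = a 0 := by
  classical
  have hNo : ∀ v : Fin 1 → Bool, NoAdj v := fun v i hi => absurd hi (by omega)
  have huniv : (univ : Finset (Fin 1 → Bool)) = {fun _ => true, fun _ => false} := by
    ext v
    simp only [mem_univ, mem_insert, mem_singleton, true_iff]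
    cases h : v 0
    · right; funext i; rw [Subsingleton.elim i 0, h]
    · left; funext i; rw [Subsingleton.elim i 0, h]
  have hne : (fun _ : Fin 1 => true) ≠ (fun _ : Fin 1 => false) := fun h => by
    have := congrFun h 0; simp at this
  unfold endSum
  rw [huniv, sum_insert (by simpa using hne), sum_singleton, sum_insert (by simpa using hne), sum_singleton]
  simp [hNo, wordWt]

/-! ## The quadratic potential (eigenbasis of `[[1,1],[2,0]]`) -/

/-- `qf A B = 5A² + 2AB + 2B²`. [folklore] -/
def qf (A B : ℝ) : ℝ := 5 * A ^ 2 + 2 * A * B + 2 * B ^ 2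

/-- `(A + B)² ≤ qf A B`. [folklore] -/
private theorem sq_add_le_qf (A B : ℝ) : (A + B) ^ 2 ≤ qf A B := by
  unfold qf; nlinarith [sq_nonneg A, sq_nonneg B, sq_nonneg (2 * A)]

/-- `A² ≤ qf A B`. [folklore] -/
private theorem sq_le_qf (A B : ℝ) : A ^ 2 ≤ qf A B := by
  unfold qf; nlinarith [sq_nonneg (A + 2 * B), sq_nonneg A]

/-- The potential is non-negative. [folklore] -/
private theorem qf_nonneg (A B : ℝ) : 0 ≤ qf A B := le_trans (sq_nonneg _) (sq_add_le_qf A B)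

/-- **Unsigned step** (`b = 1`, `a = 2`): the potential at most quadruples (eigenvalue `2`):
`qf (A + B) (2A) ≤ 4·qf A B` (equality on the Perron direction `A = B`).
[cite: Stanley2012EC1, §4.7 (transfer-matrix method); the potential inequality is supplied here] -/
theorem qf_step_pos (A B : ℝ) : qf (A + B) (2 * A) ≤ 4 * qf A B := by
  unfold qf; nlinarith [sq_nonneg (A - B)]

/-- **Signed step** (`b = −1`, `a = 2`): the potential CONTRACTS relative to `4`:
`qf (−(A + B)) (2A) ≤ (64/25)·qf A B`, i.e. a factor `(4/5)²·4` (the sign-twisted transfer matrix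
`[[−1,2],[−1,0]]` has operator norm `1.59 < 1.6` in this basis).
[cite: Stanley2012EC1, §4.7 (transfer-matrix method); the potential inequality is supplied here] -/
theorem qf_step_neg (A B : ℝ) : qf (-(A + B)) (2 * A) ≤ 64 / 25 * qf A B := by
  unfold qf; nlinarith [sq_nonneg (95 * A - 11 * B), sq_nonneg B]

/-- The initial potential: `qf b₀ a₀ ≤ 17` for `|b₀| ≤ 1`, `0 ≤ a₀ ≤ 2`. [folklore] -/
private theorem qf_init_le {a₀ b₀ : ℝ} (ha : 0 ≤ a₀) (ha' : a₀ ≤ 2) (hb : |b₀| ≤ 1) : qf b₀ a₀ ≤ 17 := by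
  have hb' := abs_le.mp hb
  unfold qf
  nlinarith [hb'.1, hb'.2, sq_nonneg b₀, mul_nonneg ha (by linarith : (0:ℝ) ≤ 2 - a₀)]

/-! ## Iterating the potential -/

/-- **Potential bound along the word.**  Site `0`: `0 ≤ a_0 ≤ 2`, `|b_0| ≤ 1`; sites `i ≥ 1`: `a_i = 2`,
`b_i ∈ {1, −1}`, and `b_i = −1` on the (ℕ-coded) set `S`:
`qf(A_j, B_j) ≤ 17 · 4^j · (16/25)^{#{i ∈ S : 1 ≤ i ≤ j}}`.
[cite: Stanley2012EC1, §4.7 (transfer-matrix method); bound supplied here] -/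
theorem qf_endSum_le (a b : ℕ → ℝ) (ha0 : 0 ≤ a 0) (ha0' : a 0 ≤ 2) (hb0 : |b 0| ≤ 1)
    (ha : ∀ i, 1 ≤ i → a i = 2) (hb : ∀ i, 1 ≤ i → b i = 1 ∨ b i = -1)
    (S : Finset ℕ) (hS : ∀ i ∈ S, 1 ≤ i → b i = -1) (j : ℕ) :
    qf (endSum a b j true) (endSum a b j false)
      ≤ 17 * 4 ^ j * (16 / 25 : ℝ) ^ (S.filter fun i => 1 ≤ i ∧ i ≤ j).card := by
  induction j with
  | zero =>
    obtain ⟨h1, h2⟩ := endSum_zero a b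
    rw [h1, h2]
    have hc : (S.filter fun i => 1 ≤ i ∧ i ≤ 0).card = 0 := by
      rw [Finset.card_eq_zero, Finset.filter_eq_empty_iff]
      intro i _ h; omega
    rw [hc, pow_zero, pow_zero, mul_one, mul_one]
    exact qf_init_le ha0 ha0' hb0
  | succ j ih =>
    rw [endSum_succ_true, endSum_succ_false, ha (j + 1) (by omega)]
    set A := endSum a b j true
    set B := endSum a b j false
    have hq := qf_nonneg A B
    by_cases hmem : (j + 1) ∈ S
    · have hcard : (S.filter fun i => 1 ≤ i ∧ i ≤ j + 1).card = (S.filter fun i => 1 ≤ i ∧ i ≤ j).card + 1 := by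
        have : (S.filter fun i => 1 ≤ i ∧ i ≤ j + 1) = insert (j + 1) (S.filter fun i => 1 ≤ i ∧ i ≤ j) := by
          ext i
          simp only [mem_filter, mem_insert]
          constructor
          · rintro ⟨hi, h1, h2⟩
            by_cases h : i = j + 1
            · exact Or.inl h
            · exact Or.inr ⟨hi, h1, by omega⟩
          · rintro (h | ⟨hi, h1, h2⟩)
            · subst h; exact ⟨hmem, by omega, le_rfl⟩
            · exact ⟨hi, h1, by omega⟩
        rw [this, card_insert_of_notMem (by simp)]
      rw [hcard, pow_succ, pow_succ, hS _ hmem (by omega)]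
      have hstep := qf_step_neg A B
      rw [show (-1 : ℝ) * (A + B) = -(A + B) by ring]
      nlinarith [hstep, ih, hq]
    · have hcard : (S.filter fun i => 1 ≤ i ∧ i ≤ j + 1).card = (S.filter fun i => 1 ≤ i ∧ i ≤ j).card := by
        congr 1
        ext i
        simp only [mem_filter]
        constructor
        · rintro ⟨hi, h1, h2⟩
          have : i ≠ j + 1 := fun h => hmem (h ▸ hi)
          exact ⟨hi, h1, by omega⟩
        · rintro ⟨hi, h1, h2⟩
          exact ⟨hi, h1, by omega⟩
      rw [hcard, pow_succ]
      have h16 : (0 : ℝ) ≤ (16 / 25 : ℝ) ^ (S.filter fun i => 1 ≤ i ∧ i ≤ j).card := by positivity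
      rcases hb (j + 1) (by omega) with hbj | hbj
      · rw [hbj, one_mul]
        have hstep := qf_step_pos A B
        nlinarith [hstep, ih, hq, h16]
      · rw [hbj, show (-1 : ℝ) * (A + B) = -(A + B) by ring]
        have hstep := qf_step_neg A B
        nlinarith [hstep, ih, hq, h16]

/-! ## Totals over linear words -/

open scoped Classical in
/-- Total over words of length `j+1`. [cite: Stanley2012EC1, §4.7 (transfer-matrix method)] -/
theorem total_eq (a b : ℕ → ℝ) (j : ℕ) :
    ∑ v : Fin (j + 1) → Bool, (if NoAdj v then wordWt a b v else 0) = endSum a b j true + endSum a b j false := by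
  unfold endSum
  rw [← sum_add_distrib]
  refine sum_congr rfl fun v _ => ?_
  by_cases hv : NoAdj v
  · rw [if_pos hv]
    cases v (Fin.last j)
    · rw [if_neg (fun h => Bool.false_ne_true h.2), if_pos ⟨hv, rfl⟩, zero_add]
    · rw [if_pos ⟨hv, rfl⟩, if_neg (fun h => Bool.false_ne_true h.2.symm), add_zero]
  · rw [if_neg hv, if_neg (fun h => hv h.1), if_neg (fun h => hv h.1), add_zero]

/-- From a bound on the square to a bound on the absolute value. [folklore] -/
private theorem abs_le_of_sq_le {x y : ℝ} (hy : 0 ≤ y) (h : x ^ 2 ≤ y ^ 2) : |x| ≤ y :=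
  abs_le_of_sq_le_sq' h hy |>.elim (fun h1 h2 => abs_le.mpr ⟨h1, h2⟩)

/-- `17 · 4^j · (16/25)^d ≤ (5 · 2^j · (4/5)^d)²`. [folklore] -/
private theorem pot_le_sq (j d : ℕ) : (17 : ℝ) * 4 ^ j * (16 / 25 : ℝ) ^ d ≤ (5 * 2 ^ j * (4 / 5 : ℝ) ^ d) ^ 2 := by
  have h4 : (4 : ℝ) ^ j = (2 ^ j) ^ 2 := by rw [← pow_mul, mul_comm, pow_mul]; norm_num
  have h16 : (16 / 25 : ℝ) ^ d = ((4 / 5 : ℝ) ^ d) ^ 2 := by rw [← pow_mul, mul_comm, pow_mul]; norm_num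
  rw [h4, h16]
  nlinarith [pow_nonneg (by norm_num : (0:ℝ) ≤ 2 ^ j) 2, pow_nonneg (by norm_num : (0:ℝ) ≤ (4/5 : ℝ) ^ d) 2,
    mul_nonneg (pow_nonneg (by norm_num : (0:ℝ) ≤ 2 ^ j) 2) (pow_nonneg (by norm_num : (0:ℝ) ≤ (4/5 : ℝ) ^ d) 2)]

open scoped Classical in
/-- **Signed linear total**: `|Σ_{v hard-core linear, length j+1} wordWt a b v| ≤ 5 · 2^j · (4/5)^{#{i ∈ S : 1 ≤ i ≤ j}}`
under the hypotheses of `qf_endSum_le`. [cite: Stanley2012EC1, §4.7 (transfer-matrix method); bound supplied here] -/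
theorem abs_total_le (a b : ℕ → ℝ) (ha0 : 0 ≤ a 0) (ha0' : a 0 ≤ 2) (hb0 : |b 0| ≤ 1)
    (ha : ∀ i, 1 ≤ i → a i = 2) (hb : ∀ i, 1 ≤ i → b i = 1 ∨ b i = -1)
    (S : Finset ℕ) (hS : ∀ i ∈ S, 1 ≤ i → b i = -1) (j : ℕ) :
    |∑ v : Fin (j + 1) → Bool, (if NoAdj v then wordWt a b v else 0)|
      ≤ 5 * 2 ^ j * (4 / 5 : ℝ) ^ (S.filter fun i => 1 ≤ i ∧ i ≤ j).card := by
  rw [total_eq]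
  set d := (S.filter fun i => 1 ≤ i ∧ i ≤ j).card
  have hq := qf_endSum_le a b ha0 ha0' hb0 ha hb S hS j
  have hS2 := sq_add_le_qf (endSum a b j true) (endSum a b j false)
  exact abs_le_of_sq_le (by positivity) ((hS2.trans hq).trans (pot_le_sq j d))

/-- **Signed partial total, last letter `1`**: `|A_j| ≤ 5 · 2^j · (4/5)^{#…}`. [cite: Stanley2012EC1, §4.7 (transfer-matrix method); bound supplied here] -/
theorem abs_endSum_true_le (a b : ℕ → ℝ) (ha0 : 0 ≤ a 0) (ha0' : a 0 ≤ 2) (hb0 : |b 0| ≤ 1)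
    (ha : ∀ i, 1 ≤ i → a i = 2) (hb : ∀ i, 1 ≤ i → b i = 1 ∨ b i = -1)
    (S : Finset ℕ) (hS : ∀ i ∈ S, 1 ≤ i → b i = -1) (j : ℕ) :
    |endSum a b j true| ≤ 5 * 2 ^ j * (4 / 5 : ℝ) ^ (S.filter fun i => 1 ≤ i ∧ i ≤ j).card := by
  set d := (S.filter fun i => 1 ≤ i ∧ i ≤ j).card
  have hq := qf_endSum_le a b ha0 ha0' hb0 ha hb S hS j
  have hS2 := sq_le_qf (endSum a b j true) (endSum a b j false)
  exact abs_le_of_sq_le (by positivity) ((hS2.trans hq).trans (pot_le_sq j d))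

/-! ## Cyclic words: split on the first letter (no trace identity needed) -/

/-- Cyclic hard-core constraint on a word of length `j+1`: no two consecutive zeros, and not both end
letters zero. [cite: Stanley2012EC1, §4.7 (transfer-matrix method, Theorem 4.7.2: closed walks)] -/
def CycHardCore {j : ℕ} (v : Fin (j + 1) → Bool) : Prop :=
  NoAdj v ∧ ¬ (v 0 = false ∧ v (Fin.last j) = false)

open scoped Classical in
/-- The signed weighted sum over cyclic hard-core words of length `j+1`.
[cite: Stanley2012EC1, §4.7 (transfer-matrix method, Theorem 4.7.2)] -/
def cycSum (a b : ℕ → ℝ) (j : ℕ) : ℝ :=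
  ∑ v : Fin (j + 1) → Bool, if CycHardCore v then wordWt a b v else 0

/-- Killing the first letter `0`: with `a 0 := 0` the weight vanishes on words starting with `0` and is
unchanged otherwise. [folklore] -/
private theorem wordWt_update_a (a b : ℕ → ℝ) {j : ℕ} (v : Fin (j + 1) → Bool) :
    wordWt (Function.update a 0 0) b v = if v 0 = false then 0 else wordWt a b v := by
  unfold wordWt
  split_ifs with h0
  · apply prod_eq_zero (mem_univ (0 : Fin (j + 1)))
    rw [if_pos h0]
    simp
  · refine prod_congr rfl fun i _ => ?_
    by_cases hi : i = 0
    · subst hi; rw [if_neg h0, if_neg h0]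
    · have : i.val ≠ 0 := fun h => hi (Fin.ext h)
      rw [Function.update_of_ne this]

/-- Killing the first letter `1`: with `b 0 := 0`. [folklore] -/
private theorem wordWt_update_b (a b : ℕ → ℝ) {j : ℕ} (v : Fin (j + 1) → Bool) :
    wordWt a (Function.update b 0 0) v = if v 0 = true then 0 else wordWt a b v := by
  unfold wordWt
  split_ifs with h0
  · apply prod_eq_zero (mem_univ (0 : Fin (j + 1)))
    simp [h0]
  · refine prod_congr rfl fun i _ => ?_
    by_cases hi : i = 0
    · subst hi
      have h0' : v 0 = false := by cases h : v 0 <;> simp_all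
      rw [if_pos h0', if_pos h0']
    · have : i.val ≠ 0 := fun h => hi (Fin.ext h)
      rw [Function.update_of_ne this]

/-- **First-letter split**: `cycSum = (A'_j + B'_j) + A''_j` where `'` uses `a_0 := 0` (words starting with `1`,
any last letter) and `''` uses `b_0 := 0` (words starting with `0`, last letter forced to `1`).
[cite: Stanley2012EC1, §4.7 (transfer-matrix method); the split replaces the trace of Theorem 4.7.2] -/
theorem cycSum_eq (a b : ℕ → ℝ) (j : ℕ) :
    cycSum a b j = (endSum (Function.update a 0 0) b j true + endSum (Function.update a 0 0) b j false)
      + endSum a (Function.update b 0 0) j true := by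
  classical
  rw [← total_eq]
  unfold cycSum endSum
  rw [← sum_add_distrib]
  refine sum_congr rfl fun v _ => ?_
  rw [wordWt_update_a, wordWt_update_b]
  unfold CycHardCore
  by_cases hv : NoAdj v
  · rcases Bool.eq_false_or_eq_true (v 0) with h0 | h0 <;>
      rcases Bool.eq_false_or_eq_true (v (Fin.last j)) with hl | hl <;> simp [hv, h0, hl]
  · simp [hv]

/-- **Signed cyclic total**: site `0` with `0 ≤ a_0 ≤ 2`, `|b_0| ≤ 1`; sites `i ≥ 1` with `a_i = 2`, `b_i ∈ {±1}`,
`b_i = −1` on `S`:  `|cycSum a b j| ≤ 10 · 2^j · (4/5)^{#{i ∈ S : 1 ≤ i ≤ j}}`.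
[cite: Stanley2012EC1, §4.7 (transfer-matrix method); bound supplied here] -/
theorem abs_cycSum_le (a b : ℕ → ℝ) (ha0 : 0 ≤ a 0) (ha0' : a 0 ≤ 2) (hb0 : |b 0| ≤ 1)
    (ha : ∀ i, 1 ≤ i → a i = 2) (hb : ∀ i, 1 ≤ i → b i = 1 ∨ b i = -1)
    (S : Finset ℕ) (hS : ∀ i ∈ S, 1 ≤ i → b i = -1) (j : ℕ) :
    |cycSum a b j| ≤ 10 * 2 ^ j * (4 / 5 : ℝ) ^ (S.filter fun i => 1 ≤ i ∧ i ≤ j).card := by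
  rw [cycSum_eq]
  set a' := Function.update a 0 0
  set b' := Function.update b 0 0
  have ha'0 : a' 0 = 0 := Function.update_self ..
  have hb'0 : b' 0 = 0 := Function.update_self ..
  have ha' : ∀ i, 1 ≤ i → a' i = 2 := fun i hi => by
    rw [show a' i = a i from Function.update_of_ne (by omega) ..]; exact ha i hi
  have hb' : ∀ i, 1 ≤ i → b' i = 1 ∨ b' i = -1 := fun i hi => by
    rw [show b' i = b i from Function.update_of_ne (by omega) ..]; exact hb i hi
  have hS' : ∀ i ∈ S, 1 ≤ i → b' i = -1 := fun i hi h1 => by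
    rw [show b' i = b i from Function.update_of_ne (by omega) ..]; exact hS i hi h1
  have h1 := abs_total_le a' b (by rw [ha'0]) (by rw [ha'0]; norm_num) hb0 ha' hb S hS j
  rw [total_eq] at h1
  have h2 := abs_endSum_true_le a b' ha0 ha0' (by rw [hb'0]; norm_num) ha hb' S hS' j
  calc |endSum a' b j true + endSum a' b j false + endSum a b' j true|
      ≤ |endSum a' b j true + endSum a' b j false| + |endSum a b' j true| := abs_add_le _ _
    _ ≤ _ := by linarith

/-! ## The fugacity-2 hard-core gas on a cycle with a sign on a set of occupied sites -/

/-- The sign weight of a set `I ⊆ ℕ`: `−1` on `I`, `+1` elsewhere. [folklore] -/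
def signOf (I : Finset ℕ) (i : ℕ) : ℝ := if i ∈ I then -1 else 1

/-- **Parity bias of the number of ones in `I` under the fugacity-2 hard-core weights on a cycle of length
`j+1`**: `|Σ_{v cyclic hard-core} 2^{#zeros v} (−1)^{#(I ∩ ones v)}| ≤ 10 · 2^j · (4/5)^{#(I ∩ [1, j])}`,
in the product form `wordWt 2 (signOf I)`.  (The total weight `Σ_v 2^{#zeros v}` is `2^{j+1} + (−1)^{j+1}`.)
[cite: Stanley2012EC1, §4.7 (transfer-matrix method); bound supplied here] -/
theorem abs_cycSum_two_sign_le (I : Finset ℕ) (j : ℕ) :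
    |cycSum (fun _ => 2) (signOf I) j| ≤ 10 * 2 ^ j * (4 / 5 : ℝ) ^ (I.filter fun i => 1 ≤ i ∧ i ≤ j).card := by
  refine abs_cycSum_le (fun _ => 2) (signOf I) (by norm_num) (by norm_num) ?_ (fun _ _ => rfl) ?_ I ?_ j
  · unfold signOf; split_ifs <;> simp
  · intro i _; unfold signOf; split_ifs <;> simp
  · intro i hi _; unfold signOf; rw [if_pos hi]

/-- The weight `wordWt 2 (signOf I) v` IS `2^{#zeros} · (−1)^{#(ones in I)}` (the multiplicative weights of the
transfer-matrix method, written out). [cite: Stanley2012EC1, §4.7 (transfer-matrix method); bookkeeping identity supplied here] -/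
theorem wordWt_two_signOf {j : ℕ} (I : Finset ℕ) (v : Fin j → Bool) :
    wordWt (fun _ => 2) (signOf I) v
      = (2 : ℝ) ^ (univ.filter fun i : Fin j => v i = false).card
        * (-1 : ℝ) ^ (univ.filter fun i : Fin j => v i = true ∧ i.val ∈ I).card := by
  classical
  unfold wordWt signOf
  have hfac : ∀ i : Fin j, (if v i = false then (2 : ℝ) else if i.val ∈ I then -1 else 1)
      = (if v i = false then (2 : ℝ) else 1) * (if (v i = true ∧ i.val ∈ I) then (-1 : ℝ) else 1) := by
    intro i
    cases v i <;> by_cases hi : i.val ∈ I <;> simp [hi]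
  simp_rw [hfac]
  rw [prod_mul_distrib, prod_ite, prod_const, prod_const_one, mul_one, prod_ite, prod_const, prod_const_one,
    mul_one]

end HardCoreSigned

end Literature.Probability.LatticeModels
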